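import Literature.Computability.AlgebraicComplexity.DepthThreeChasmAlgebra
import Literature.Computability.AlgebraicComplexity.DepthThreeChasmCircuits
import Literature.Computability.AlgebraicComplexity.DepthThreeChasmGKKSProofs
import Mathlib.Data.Fintype.BigOperators
import Mathlib.Data.Fintype.Sigma
import Mathlib.Algebra.BigOperators.Group.Finset.Sigma
import HarnessLib

/-!
# From `ΣΠΣΠ` expressions to `ΣΠΣ` circuits (GKKS TR13-026 §4.2–§4.3, Steps 2 and 3)

Topic `Literature/Computability/AlgebraicComplexity`; support file for the discharge of the named
fact `sigmaPiSigma_edgeSize_le_of_complexity` (`DepthThreeChasm.lean`). Given the output of the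
depth-four reduction — `f = ∑_{i<T} ∏_{j<W} p_{ij}` with `deg p_{ij} ≤ t` and all supports inside a
finite set `U` of monomials of degree `≤ t` (in the tree: `DepthReduction.SLP.exists_sum_prod`,
`GateQuotients.lean`, Tavenas 2015 Thm. 1 in the Agrawal–Vinay form) — this file carries out
Steps 2 and 3 of the printed proof of Gupta–Kamath–Kayal–Saptharishi, *Arithmetic circuits: a
chasm at depth three*, ECCC TR13-026 = SIAM J. Comput. 45 (2016), Thm. 1.1, with the algebra of
`DepthThreeChasmAlgebra.lean` and the circuits of `DepthThreeChasmCircuits.lean`: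

* Step 2 (Lemma 4.4, via Fischer's Lemma 4.3): `∏_j p_{ij}` is a combination of the `2^W` powers
  `q_{iε}^W`, `q_{iε} = ∑_j ε_j p_{ij}` (`qOf`), and every monomial `X^m`, `|m| = e ≤ t`, is a
  combination of the `2^e` powers `ℓ_{m,δ}^e` of the signed sums `ℓ_{m,δ}` of its variables
  (`linForm`, `monomial_eq_fischer`; `varList` and `prod_varList` are reused from the sibling
  discharge `DepthThreeChasmGKKSProofs.lean` of the GKKS form of the fact); so `q_{iε} = ∑_{v} a_v ℓ_v^{e_v}` over the index type
  `Idx U = Σ m ∈ U, {±1}^{|m|}` (`eq_sum_idx`) — a `Σ∧Σ∧Σ` expression.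
* Step 3 (Lemma 4.7, via Saxena's Lemma 4.6): `q^W = ∑_{u ≤ N} β_u ∏_v E_W(u · a_v ℓ_v^{e_v})`
  (`duality`), each factor is a univariate `g_{uv}(ℓ_v)` of degree `≤ tW` (`nodePoly`), which
  splits over the algebraically closed field into `lc · ∏_ρ (ℓ_v - ρ)`: a `ΣΠΣ` expression with
  `T · 2^W · (N+1)` terms of at most `#Idx U · tW` affine factors each (`sum_prod_eq_sps`).
* `exists_sps_of_sum_prod`: the resulting `ΣΠΣ` CIRCUIT (`exists_sps_circuit`) with its wire count
  `≤ (T 2^W (|U| 2^t W + 1)) · ((|U| 2^t · tW)(#τ + 2) + 1)`; `exists_circuit_of_slp3`: the same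
  starting from a straight-line program via `SLP.exists_sum_prod` (cut degree `t ≥ 1` a free
  parameter), with the explicit bound `sps3Bound`.

Everything is proved (D-0026); the definitions are the explicit data of the construction.

## References

* A. Gupta, P. Kamath, N. Kayal, R. Saptharishi, *Arithmetic circuits: a chasm at depth three*,
  ECCC TR13-026 (2013) = SIAM J. Comput. 45(3) (2016) 1064–1079: §4.2 (Lemma 4.3, 4.4), §4.3
  (Lemma 4.6, 4.7).
* S. Tavenas, *Improved bounds for reduction to depth 4 and depth 3*, Inform. and Comput. 240
  (2015) 2–11, Thm. 1 and Cor. 1 (the depth-four input).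
-/

noncomputable section

open MvPolynomial Finset

namespace Literature.Computability.AlgebraicComplexity.DepthThreeChasm

universe u v

variable {K : Type u} [Field K] {τ : Type v}

/-! ## Step 2 at the bottom: monomials as combinations of powers of signed sums of variables -/

section Bottom

/-- `|varList m| = |m|` (`varList m`, the variables of `m` listed with multiplicity, is the one of
`DepthThreeChasmGKKSProofs.lean`). [folklore] -/
theorem length_varList (m : τ →₀ ℕ) :
    (varList m).length = Multiset.card (Finsupp.toMultiset m) := by
  simp [varList]

/-- The signed sum `ℓ_{m,δ} = ∑_r δ_r X_{v_r}` of the variables `v_1, …, v_e` of `m` (with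
multiplicity) for a sign vector `δ ∈ {±1}^e` — the linear forms of Fischer's identity applied to
`X^m = X_{v_1} ⋯ X_{v_e}` (GKKS TR13-026 Lemma 4.3: "any degree `d` monomial is a projection of
`x_1 ⋯ x_d`"). [cite: GuptaKamathKayalSaptharishi2016, Lemma 4.3] -/
def linForm (m : τ →₀ ℕ) (δ : Fin (varList m).length → Fin 2) : MvPolynomial τ K :=
  ∑ r, (-1 : MvPolynomial τ K) ^ (δ r : ℕ) * X (varList m)[r.1]

/-- The sign `∏_r δ_r ∈ {±1}` of a sign vector. [folklore] -/
def sgn {e : ℕ} (δ : Fin e → Fin 2) : K := ∏ r, (-1 : K) ^ (δ r : ℕ)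

/-- `algebraMap (sgn δ) = ∏_r (-1)^{δ_r}` in any `K`-algebra. [folklore] -/
theorem algebraMap_sgn {R : Type*} [CommRing R] [Algebra K R] {e : ℕ} (δ : Fin e → Fin 2) :
    algebraMap K R (sgn δ) = ∏ r, (-1 : R) ^ (δ r : ℕ) := by
  simp [sgn, map_prod]

/-- **Fischer's identity for a monomial** (GKKS TR13-026 Lemma 4.3 and the remark after it): with
`e = |m|`, `X^m = (2^e e!)⁻¹ ∑_{δ ∈ {±1}^e} sgn(δ) ℓ_{m,δ}^e`.
[cite: GuptaKamathKayalSaptharishi2016, Lemma 4.3] -/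
theorem monomial_eq_fischer [CharZero K] (m : τ →₀ ℕ) :
    monomial m (1 : K) =
      algebraMap K (MvPolynomial τ K)
          ((2 ^ (varList m).length * ((varList m).length).factorial : ℕ) : K)⁻¹ *
        ∑ δ : Fin (varList m).length → Fin 2,
          algebraMap K (MvPolynomial τ K) (sgn δ) * linForm (K := K) m δ ^ (varList m).length := by
  rw [← prod_varList, ← Fin.prod_univ_fun_getElem]
  have h := fischer_inv (K := K) (fun r : Fin (varList m).length =>
    (X (varList m)[r.1] : MvPolynomial τ K))
  simp only [Fintype.card_fin] at h
  rw [h]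
  refine congrArg _ (Finset.sum_congr rfl fun δ _ => ?_)
  rw [algebraMap_sgn]
  rfl

variable [DecidableEq τ]

/-- The coefficient vector of `ℓ_{m,δ}`: the coefficient of `X_j` is the signed number of
occurrences of `j` among the variables of `m`. [folklore] -/
def linCoeff (m : τ →₀ ℕ) (δ : Fin (varList m).length → Fin 2) : τ → K :=
  fun j => ∑ r ∈ (Finset.univ : Finset (Fin (varList m).length)).filter
    (fun r => (varList m)[r.1] = j), (-1 : K) ^ (δ r : ℕ)

/-- The affine form with coefficient vector `linCoeff m δ` and constant `b` is `ℓ_{m,δ} + b`.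
[folklore] -/
theorem affVal_linCoeff [Fintype τ] (m : τ →₀ ℕ) (δ : Fin (varList m).length → Fin 2) (b : K) :
    affVal (linCoeff m δ, b) = linForm m δ + C b := by
  rw [affVal_apply, linForm]
  congr 1
  have h := Finset.sum_fiberwise (Finset.univ : Finset (Fin (varList m).length))
    (fun r => (varList m)[r.1]) (fun r => (-1 : MvPolynomial τ K) ^ (δ r : ℕ) * X (varList m)[r.1])
  rw [← h]
  refine Finset.sum_congr rfl fun j _ => ?_
  rw [linCoeff, Finset.sum_smul]
  refine Finset.sum_congr rfl fun r hr => ?_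
  rw [(Finset.mem_filter.1 hr).2, smul_eq_C_mul, map_pow, map_neg, map_one]

end Bottom

/-! ## The index type of Step 2 and the `Σ∧Σ∧Σ` form of a low-degree polynomial -/

section Index

variable (U : Finset (τ →₀ ℕ))

/-- The index type of the powers `ℓ_{m,δ}^{|m|}` spanning the polynomials with support in `U`:
pairs `(m ∈ U, δ ∈ {±1}^{|m|})` (the inner `Σ` layer of the `Σ∧Σ∧Σ` circuit of TR13-026 §4.2).
[cite: GuptaKamathKayalSaptharishi2016, Lemma 4.4] -/
abbrev Idx : Type v := Σ m : {m // m ∈ U}, (Fin (varList m.1).length → Fin 2)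

variable {U}

/-- The exponent `e_v = |m|` of the index `v = (m, δ)`. [cite: GuptaKamathKayalSaptharishi2016, Lemma 4.4] -/
def expo (v : Idx U) : ℕ := (varList v.1.1).length

/-- The linear form `ℓ_v = ℓ_{m,δ}` of the index `v = (m, δ)`. [cite: GuptaKamathKayalSaptharishi2016, Lemma 4.4] -/
def lin (v : Idx U) : MvPolynomial τ K := linForm v.1.1 v.2

/-- The coefficient `a_v(q) = coeff_m(q) · (2^e e!)⁻¹ · sgn(δ)` of `ℓ_v^{e_v}` in the `Σ∧Σ`
expression of `q`. [cite: GuptaKamathKayalSaptharishi2016, Lemma 4.4] -/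
def coefA (q : MvPolynomial τ K) (v : Idx U) : K :=
  coeff v.1.1 q * ((2 ^ expo v * (expo v).factorial : ℕ) : K)⁻¹ * sgn v.2

/-- `#Idx U = ∑_{m ∈ U} 2^{|m|} ≤ |U| · 2^t` when all monomials of `U` have degree `≤ t`.
[cite: GuptaKamathKayalSaptharishi2016, Lemma 4.4 (size `(b s₁ n) · 2^b`)] -/
theorem card_idx_le {t : ℕ} (hU : ∀ m ∈ U, Multiset.card (Finsupp.toMultiset m) ≤ t) :
    Fintype.card (Idx U) ≤ U.card * 2 ^ t := by
  rw [Fintype.card_sigma]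
  calc ∑ m : {m // m ∈ U}, Fintype.card (Fin (varList m.1).length → Fin 2)
      ≤ ∑ _m : {m // m ∈ U}, 2 ^ t := by
        refine Finset.sum_le_sum fun m _ => ?_
        rw [Fintype.card_fun, Fintype.card_fin, Fintype.card_fin, length_varList]
        exact Nat.pow_le_pow_right two_pos (hU m.1 m.2)
    _ = U.card * 2 ^ t := by
        rw [Finset.sum_const, smul_eq_mul, Finset.card_univ, Fintype.card_coe]

/-- The exponents are bounded by the degree bound of `U`. [folklore] -/
theorem expo_le {t : ℕ} (hU : ∀ m ∈ U, Multiset.card (Finsupp.toMultiset m) ≤ t) (v : Idx U) :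
    expo v ≤ t := by
  rw [expo, length_varList]
  exact hU v.1.1 v.1.2

/-- **The `Σ∧Σ` form of a polynomial with support in `U`** (TR13-026 proof of Lemma 4.4:
"apply Lemma 4.3 to each monomial and express `Q_{ij}` as a `Σ∧^{[b]}Σ` circuit"):
`q = ∑_{v ∈ Idx U} a_v(q) ℓ_v^{e_v}`. [cite: GuptaKamathKayalSaptharishi2016, Lemma 4.4] -/
theorem eq_sum_idx [CharZero K] {q : MvPolynomial τ K} (hq : q.support ⊆ U) :
    q = ∑ v : Idx U, algebraMap K (MvPolynomial τ K) (coefA q v) * lin v ^ expo v := by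
  classical
  have h1 : q = ∑ m ∈ U, coeff m q • monomial m (1 : K) := by
    conv_lhs => rw [← support_sum_monomial_coeff q]
    rw [Finset.sum_subset hq]
    · refine Finset.sum_congr rfl fun m _ => ?_
      rw [smul_monomial, smul_eq_mul, mul_one]
    · intro m _ hm
      rw [notMem_support_iff.1 hm, monomial_zero]
  conv_lhs => rw [h1, ← Finset.sum_coe_sort U]
  rw [Fintype.sum_sigma]
  refine Finset.sum_congr rfl fun m _ => ?_
  rw [monomial_eq_fischer, Finset.mul_sum, Finset.smul_sum]
  refine Finset.sum_congr rfl fun δ _ => ?_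
  simp only [coefA, expo, lin, map_mul, Algebra.smul_def, MvPolynomial.algebraMap_eq]
  ring

end Index

/-! ## Step 3: duality and splitting -/

section Step3

/-- The univariate `g_{u,v} = ∑_{e ≤ W} (u^e a^e / e!) X^{e₀ e}` with `E_W(u · a ℓ^{e₀}) = g(ℓ)`
(TR13-026 proof of Lemma 4.7: `f'_{ij}(t) = f_{ij}(t^{e_j})`, of degree `≤ ba`).
[cite: GuptaKamathKayalSaptharishi2016, Lemma 4.7] -/
def nodePoly (W u : ℕ) (a : K) (e₀ : ℕ) : Polynomial K :=
  ∑ e ∈ Finset.range (W + 1),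
    Polynomial.C ((((e.factorial : ℕ) : K)⁻¹) * ((u : ℕ) : K) ^ e * a ^ e) * Polynomial.X ^ (e₀ * e)

/-- `deg g_{u,v} ≤ e₀ W`. [cite: GuptaKamathKayalSaptharishi2016, Lemma 4.7] -/
theorem natDegree_nodePoly_le (W u : ℕ) (a : K) (e₀ : ℕ) :
    (nodePoly W u a e₀).natDegree ≤ e₀ * W :=
  natDegree_truncExp_le W e₀ _ a

variable [DecidableEq τ] {U : Finset (τ →₀ ℕ)}

/-- The affine factors of the term `(i, ε, u)`: for every index `v` and every root `ρ` of
`g_{u,v}`, the affine form `ℓ_v - ρ` (TR13-026 proof of Lemma 4.7: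
"`T = ∑_i ∏_j ∏_k (ℓ_j - α_{ijk})`"). [cite: GuptaKamathKayalSaptharishi2016, Lemma 4.7] -/
def spsList [Fintype τ] (W : ℕ) (q : MvPolynomial τ K) (u : ℕ) : List ((τ → K) × K) :=
  (Finset.univ : Finset (Idx U)).toList.flatMap fun v =>
    ((nodePoly W u (coefA q v) (expo v)).roots.toList.map fun ρ => (linCoeff v.1.1 v.2, -ρ))

/-- The scalar of the term: the product of the leading coefficients of the `g_{u,v}`.
[cite: GuptaKamathKayalSaptharishi2016, Lemma 4.7] -/
def lcProd (W : ℕ) (q : MvPolynomial τ K) (u : ℕ) : K :=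
  ∏ v : Idx U, (nodePoly W u (coefA q v) (expo v)).leadingCoeff

omit [DecidableEq τ] in
/-- Products over a `flatMap` of lists. [folklore] -/
theorem prod_map_flatMap {α β M : Type*} [CommMonoid M] (l : List α) (F : α → List β)
    (h : β → M) : ((l.flatMap F).map h).prod = (l.map fun a => ((F a).map h).prod).prod := by
  induction l with
  | nil => simp
  | cons a l ih => simp [List.flatMap_cons, List.map_append, List.prod_append, ih]

/-- The number of affine factors of a term is at most `#Idx U · tW`. [cite:
GuptaKamathKayalSaptharishi2016, Lemma 4.7 ("each multiplication gate has fanin at most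
`O(s₂ab)`")] -/
theorem length_spsList_le [Fintype τ] [IsAlgClosed K] {t : ℕ}
    (hU : ∀ m ∈ U, Multiset.card (Finsupp.toMultiset m) ≤ t) (W : ℕ) (q : MvPolynomial τ K)
    (u : ℕ) : (spsList (U := U) W q u).length ≤ Fintype.card (Idx U) * (t * W) := by
  rw [spsList, List.length_flatMap]
  have hbound : ∀ x ∈ ((Finset.univ : Finset (Idx U)).toList.map fun v =>
      (((nodePoly W u (coefA q v) (expo v)).roots.toList.map
        fun ρ => (linCoeff (K := K) v.1.1 v.2, -ρ)).length)), x ≤ t * W := by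
    intro x hx
    obtain ⟨v, -, rfl⟩ := List.mem_map.1 hx
    rw [List.length_map, Multiset.length_toList,
      (aeval_eq_leadingCoeff_mul_prod_roots (nodePoly W u (coefA q v) (expo v))
        (lin (K := K) v)).2]
    exact (natDegree_nodePoly_le _ _ _ _).trans (Nat.mul_le_mul_right _ (expo_le hU v))
  have := List.sum_le_card_nsmul _ _ hbound
  rw [List.length_map, Finset.length_toList, Finset.card_univ, smul_eq_mul] at this
  simpa [Function.comp_def] using this

/-- **Step 3 for one power** (TR13-026 Lemma 4.6 + proof of Lemma 4.7): with the weights `β` of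
`exists_dual_weights` for `N = #Idx U · W`,
`q^W = ∑_{u ≤ N} β_u · lcProd · ∏ (affine factors of (q, u))` for every `q` with support in `U`.
[cite: GuptaKamathKayalSaptharishi2016, Lemma 4.6 and 4.7] -/
theorem pow_eq_sum_sps [Fintype τ] [IsAlgClosed K] [CharZero K] (W : ℕ)
    {β : Fin (Fintype.card (Idx U) * W + 1) → K}
    (hβ : ∀ e : Fin (Fintype.card (Idx U) * W + 1),
      ∑ u : Fin (Fintype.card (Idx U) * W + 1), β u * ((u : ℕ) : K) ^ (e : ℕ) =
        if (e : ℕ) = W then ((W.factorial : ℕ) : K) else 0)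
    {q : MvPolynomial τ K} (hq : q.support ⊆ U) :
    q ^ W = ∑ u : Fin (Fintype.card (Idx U) * W + 1),
      algebraMap K (MvPolynomial τ K) (β u * lcProd (U := U) W q u) *
        ((spsList (U := U) W q u).map affVal).prod := by
  -- Saxena's duality applied to `q = ∑_v a_v ℓ_v^{e_v}`
  have hdual := duality (R := MvPolynomial τ K) (ι := Idx U) (N := Fintype.card (Idx U) * W)
    (W := W) le_rfl hβ (fun v => algebraMap K (MvPolynomial τ K) (coefA q v) * lin v ^ expo v)
  rw [← eq_sum_idx hq] at hdual
  rw [← hdual]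
  refine Finset.sum_congr rfl fun u _ => ?_
  -- each factor is a univariate in `ℓ_v`, which splits
  have hfac : ∀ v : Idx U, (∑ e ∈ Finset.range (W + 1),
      algebraMap K (MvPolynomial τ K) ((((e.factorial : ℕ) : K)⁻¹) * ((u : ℕ) : K) ^ e) *
        (algebraMap K (MvPolynomial τ K) (coefA q v) * lin v ^ expo v) ^ e) =
      algebraMap K (MvPolynomial τ K) (nodePoly W u (coefA q v) (expo v)).leadingCoeff *
        ((nodePoly W u (coefA q v) (expo v)).roots.map
          fun ρ => lin v - algebraMap K (MvPolynomial τ K) ρ).prod := by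
    intro v
    rw [truncExp_eq_aeval W (expo v) ((u : ℕ) : K) (coefA q v) (lin v)]
    exact (aeval_eq_leadingCoeff_mul_prod_roots _ _).1
  rw [Finset.prod_congr rfl fun v _ => hfac v]
  rw [Finset.prod_mul_distrib, ← map_prod, map_mul, mul_assoc]
  congr 1
  rw [lcProd]
  congr 1
  -- the list of affine factors evaluates to the product of the linear factors
  rw [spsList, prod_map_flatMap, Finset.prod_map_toList]
  refine Finset.prod_congr rfl fun v _ => ?_
  rw [List.map_map, ← Multiset.prod_coe, ← Multiset.map_coe, Multiset.coe_toList]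
  refine congrArg _ (Multiset.map_congr rfl fun ρ _ => ?_)
  simp only [Function.comp, affVal_linCoeff, lin, map_neg, MvPolynomial.algebraMap_eq]
  ring

end Step3

/-! ## Step 2 at the top and the assembled `ΣΠΣ` expression -/

section Assembly

variable [DecidableEq τ] [Fintype τ] {U : Finset (τ →₀ ℕ)}

/-- The signed combinations `q_{iε} = ∑_j ε_j p_{ij}` of the factors of the `i`-th product
(TR13-026 proof of Lemma 4.4: "express `T_i` as a sum of at most `2^a` `a`-th powers of linear
combinations of the `Q_{ij}`'s"). [cite: GuptaKamathKayalSaptharishi2016, Lemma 4.4] -/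
def qOf {T W : ℕ} (p : Fin T → Fin W → MvPolynomial τ K) (i : Fin T) (ε : Fin W → Fin 2) :
    MvPolynomial τ K :=
  ∑ j, ((-1 : K) ^ (ε j : ℕ)) • p i j

omit [DecidableEq τ] [Fintype τ] in
/-- The support of `q_{iε}` lies in `U` when all `p_{ij}` do. [folklore] -/
theorem support_qOf_subset {T W : ℕ} {p : Fin T → Fin W → MvPolynomial τ K}
    (hp : ∀ i j, (p i j).support ⊆ U) (i : Fin T) (ε : Fin W → Fin 2) :
    (qOf p i ε).support ⊆ U := by
  classical
  refine support_sum.trans (Finset.biUnion_subset.2 fun j _ => ?_)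
  exact support_smul.trans (hp i j)

omit [DecidableEq τ] [Fintype τ] in
/-- Fischer at the top: `∏_j p_{ij} = (2^W W!)⁻¹ ∑_ε sgn(ε) q_{iε}^W`.
[cite: GuptaKamathKayalSaptharishi2016, Lemma 4.3 and 4.4] -/
theorem prod_eq_fischer_qOf [CharZero K] {T W : ℕ} (p : Fin T → Fin W → MvPolynomial τ K)
    (i : Fin T) :
    ∏ j, p i j = algebraMap K (MvPolynomial τ K) ((2 ^ W * W.factorial : ℕ) : K)⁻¹ *
      ∑ ε : Fin W → Fin 2, algebraMap K (MvPolynomial τ K) (sgn ε) * qOf p i ε ^ W := by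
  have h := fischer_inv (K := K) (fun j : Fin W => p i j)
  simp only [Fintype.card_fin] at h
  rw [h]
  congr 1
  refine Finset.sum_congr rfl fun ε _ => ?_
  rw [algebraMap_sgn, qOf]
  congr 2
  refine Finset.sum_congr rfl fun j _ => ?_
  rw [Algebra.smul_def, map_pow, map_neg, map_one]

/-- **The `ΣΠΣ` expression** (TR13-026 Lemma 4.4 + 4.7 combined): with the weights `β` of
`exists_dual_weights` for `N = #Idx U · W`,
`∑_i ∏_j p_{ij} = ∑_{(i,ε,u)} c_{iεu} · ∏ (affine factors)`, an explicit `ΣΠΣ` expression with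
`T · 2^W · (N + 1)` terms. [cite: GuptaKamathKayalSaptharishi2016, Lemma 4.4 and 4.7] -/
theorem sum_prod_eq_sps [IsAlgClosed K] [CharZero K] {T W : ℕ}
    (p : Fin T → Fin W → MvPolynomial τ K) (hp : ∀ i j, (p i j).support ⊆ U)
    {β : Fin (Fintype.card (Idx U) * W + 1) → K}
    (hβ : ∀ e : Fin (Fintype.card (Idx U) * W + 1),
      ∑ u : Fin (Fintype.card (Idx U) * W + 1), β u * ((u : ℕ) : K) ^ (e : ℕ) =
        if (e : ℕ) = W then ((W.factorial : ℕ) : K) else 0) :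
    ∑ i, ∏ j, p i j =
      ∑ x : Fin T × (Fin W → Fin 2) × Fin (Fintype.card (Idx U) * W + 1),
        (((2 ^ W * W.factorial : ℕ) : K)⁻¹ * sgn x.2.1 * (β x.2.2 *
            lcProd (U := U) W (qOf p x.1 x.2.1) x.2.2)) •
          ((spsList (U := U) W (qOf p x.1 x.2.1) x.2.2).map affVal).prod := by
  rw [Fintype.sum_prod_type]
  refine Finset.sum_congr rfl fun i _ => ?_
  rw [prod_eq_fischer_qOf, Fintype.sum_prod_type, Finset.mul_sum]
  refine Finset.sum_congr rfl fun ε _ => ?_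
  rw [pow_eq_sum_sps W hβ (support_qOf_subset hp i ε), Finset.mul_sum, Finset.mul_sum]
  refine Finset.sum_congr rfl fun u _ => ?_
  simp only [Algebra.smul_def, map_mul]
  ring

/-- **The `ΣΠΣ` circuit of a `ΣΠΣΠ` expression** (GKKS TR13-026 §4.2–§4.3): if
`f = ∑_{i<T} ∏_{j<W} p_{ij}` with all supports in a set `U` of monomials of degree `≤ t`, then `f`
has a circuit of product-depth `≤ 1` with at most
`(T · 2^W · (|U| 2^t W + 1)) · ((|U| 2^t · tW) · (#τ + 2) + 1)` wires.
[cite: GuptaKamathKayalSaptharishi2016, Lemma 4.4 and 4.7] -/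
theorem exists_sps_of_sum_prod [IsAlgClosed K] [CharZero K] {T W t : ℕ}
    (p : Fin T → Fin W → MvPolynomial τ K) (U : Finset (τ →₀ ℕ))
    (hU : ∀ m ∈ U, Multiset.card (Finsupp.toMultiset m) ≤ t) (hp : ∀ i j, (p i j).support ⊆ U) :
    ∃ C : ArithCircuit K τ, C.eval = ∑ i, ∏ j, p i j ∧ C.productDepth ≤ 1 ∧
      C.edgeSize ≤ (T * 2 ^ W * (U.card * 2 ^ t * W + 1)) *
        ((U.card * 2 ^ t * (t * W)) * (Fintype.card τ + 2) + 1) := by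
  obtain ⟨β, hβ⟩ := exists_dual_weights (K := K) (Fintype.card (Idx U) * W) W
  set 𝒯 := Fin T × (Fin W → Fin 2) × Fin (Fintype.card (Idx U) * W + 1)
  set c : 𝒯 → K := fun x => ((2 ^ W * W.factorial : ℕ) : K)⁻¹ * sgn x.2.1 *
    (β x.2.2 * lcProd (U := U) W (qOf p x.1 x.2.1) x.2.2) with hc
  set A : 𝒯 → List ((τ → K) × K) := fun x =>
    spsList (U := U) W (qOf p x.1 x.2.1) x.2.2 with hA
  obtain ⟨C, hCe, hCd, hCs⟩ := exists_sps_circuit (Fintype.card (Idx U) * (t * W)) c A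
    (fun x => length_spsList_le hU W _ _)
  refine ⟨C, ?_, hCd, hCs.trans ?_⟩
  · rw [hCe, sum_prod_eq_sps p hp hβ]
  · have hI := card_idx_le hU
    have hcard : Fintype.card 𝒯 = T * 2 ^ W * (Fintype.card (Idx U) * W + 1) := by
      simp only [𝒯, Fintype.card_prod, Fintype.card_fun, Fintype.card_fin]
      ring
    rw [hcard]
    gcongr

end Assembly

/-! ## From a straight-line program: the depth-four input -/

section FromSLP

open DepthReduction

/-- The wire bound of the `ΣΠΣ` circuit obtained from a straight-line program of length `s` for
a polynomial of degree `≤ d` in `N` variables, with cut degree `t`: the bound of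
`exists_sps_of_sum_prod` at `T = (d+1) S^{2R}`, `W = 1 + 4R`, `|U| ≤ (t+1)(N+t)^t`,
`R = ⌊8d/(t+1)⌋`, `S = 4s(d+1)²` (the parameters of `SLP.exists_sum_prod`).
[cite: GuptaKamathKayalSaptharishi2016, Thm. 1.1 (proof, §4); Tavenas2015, Cor. 1] -/
def sps3Bound (N d s t : ℕ) : ℕ :=
  ((d + 1) * ((4 * s * (d + 1) ^ 2) * (4 * s * (d + 1) ^ 2)) ^ (8 * d / (t + 1)) *
      2 ^ (1 + 4 * (8 * d / (t + 1))) *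
      ((t + 1) * (N + t) ^ t * 2 ^ t * (1 + 4 * (8 * d / (t + 1))) + 1)) *
    (((t + 1) * (N + t) ^ t * 2 ^ t * (t * (1 + 4 * (8 * d / (t + 1))))) * (N + 2) + 1)

/-- **`ΣΠΣ` circuit of a value of a straight-line program** (Tavenas' depth-four step, then GKKS
Steps 2–3): a value of total degree `≤ d` of a straight-line program of length `s` over `N`
variables has, for every cut degree `t ≥ 1`, a circuit of product-depth `≤ 1` with at most
`sps3Bound N d s t` wires. [cite: Tavenas2015, Thm. 1 and Cor. 1; GuptaKamathKayalSaptharishi2016,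
Lemma 4.4 and 4.7] -/
theorem exists_circuit_of_slp3 [Fintype τ] [DecidableEq τ] [IsAlgClosed K] [CharZero K]
    (S : SLP K τ) {i : ℕ} (hi : i < S.len) {d t : ℕ} (hd : (S.val i).totalDegree ≤ d)
    (ht : 1 ≤ t) :
    ∃ C : ArithCircuit K τ, C.eval = S.val i ∧ C.productDepth ≤ 1 ∧
      C.edgeSize ≤ sps3Bound (Fintype.card τ) d S.len t := by
  obtain ⟨L, hsum, hlen, hT⟩ := S.exists_sum_prod d ht hi hd
  set W := 1 + 4 * (8 * d / (t + 1)) with hW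
  let p : Fin L.length → Fin W → MvPolynomial τ K := fun τ' π => (L[τ'.val]).getD π.val 1
  let U : Finset (τ →₀ ℕ) := (Finset.univ : Finset (Fin L.length × Fin W)).biUnion
    fun x => (p x.1 x.2).support
  have hp : ∀ τ' π, (p τ' π).support ⊆ U := fun τ' π =>
    Finset.subset_biUnion_of_mem (fun x : Fin L.length × Fin W => (p x.1 x.2).support)
      (Finset.mem_univ (τ', π))
  have hU : ∀ m ∈ U, Multiset.card (Finsupp.toMultiset m) ≤ t := by
    intro m hm
    simp only [U, Finset.mem_biUnion, Finset.mem_univ, true_and] at hm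
    obtain ⟨⟨τ', π⟩, hm⟩ := hm
    rw [Finsupp.card_toMultiset]
    refine (le_totalDegree hm).trans ?_
    rcases getD_one_mem_or (L[τ'.val]) π.val with h | h
    · exact (hT _ (List.getElem_mem _)).2 _ h
    · simp only [p] at hm ⊢
      rw [h, totalDegree_one]
      exact Nat.zero_le _
  obtain ⟨C, hC, hpd, hsize⟩ := exists_sps_of_sum_prod p U hU hp
  refine ⟨C, ?_, hpd, hsize.trans ?_⟩
  · rw [hC, ← hsum]
    have : ∀ τ' : Fin L.length, ∏ π : Fin W, p τ' π = (L[τ'.val]).prod := fun τ' =>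
      prod_getD_one _ W (hT _ (List.getElem_mem _)).1
    simp only [this]
    exact Fin.sum_univ_fun_getElem L List.prod
  · have hUcard : U.card ≤ (t + 1) * (Fintype.card τ + t) ^ t := by
      apply card_le_of_degree_le U ht
      intro m hm
      have := hU m hm
      rwa [Finsupp.card_toMultiset] at this
    rw [sps3Bound, ← hW]
    gcongr

end FromSLP

end Literature.Computability.AlgebraicComplexity.DepthThreeChasm
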